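import Summits.Ventures.PercRepro.LemmaBPlusSub
import Summits.Ventures.PercRepro.LemmaBPlusSubs

/-!
# C-017 in the kernel: the class sum of `kernel17` as a bit-code computation

typer-2's `ClassPositive.lean` / `Injective.lean` reduce C-017 (`P(a~b)·P(a≁b) ≤ P(exactly one pair)`,
mine-3's Q1) on every multigraph with `≤ N` vertices to the FINITE census
`ClassPositiveSimpleInjUpTo 3 N kernel17`: the full-cube class sum `Σ_ρ kernel17(Π(ρ), Π(ρᶜ))` is
nonnegative on every simple graph with `≤ N` vertices and every injective 3-marking.  This file makes
that class sum a kernel computation in the style of `LemmaBPlusCodes` / `LemmaBPlusSubs`: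

* `rowOf3` / `row3D` — the computable row (`rgs3` index: `abc, ab|c, ac|b, bc|a, a|b|c`) of the marked
  partition of three marks (p6's breadth-first `connD`); **`markedPartition_eq_ker_iff`** identifies
  it with typer-2's row indicator `rowInd3`, so `kernel17` is the integer kernel `kernel17Z` of the two
  rows (`kernel17_eq`) and `cubeSumQuad ![a, b, c] kernel17` is the integer sum `cubeSum17Z`
  (`cubeSumQuad_kernel17_eq`);
* `faceSlack17Z` — the same sum on the face `[⊥, u]` (the full cube of the spanning subgraph with edge
  set `u`); **`cubeSum17Z_eq_faceSlack17Z_sub`** — a subgraph's class sum is a face slack of the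
  supergraph (`SubOf`, `ext`, `imageMask` of `LemmaBPlusSub`);
* on codes: the rows of all `2^k` configurations in one base-`16` table (`rowTable3M`), the kernel
  `kernel17Z + 1 ∈ {0, 1, 2}` packed into `k17Packed` (`k17Entry_eq`), the face `[⊥, u]` as the listed
  sub-masks of `u` (`subScore17`, `subSize`; `faceSlack17Z_eq_table`); **`Check17`** is the Boolean the
  kernel decides (`Σ_u 2^{|u|} = 3^k` points), `Range17` its slices (`range17_trans`,
  `check17_of_range17`), and **`faceSlack17Z_nonneg_of_check`** the bridge back.

`C017K5.lean` decides `Check17` for `K₅` with marks `0, 1, 2`; `C017UpTo5.lean` assembles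
`c017UpTo5 : C017UpTo 5`.
-/

namespace PercRepro

/-- **The integer kernel of C-017 on rows** (`kernel17` through the rows `abc = 0, ab|c = 1, ac|b = 2,
bc|a = 3, a|b|c = 4`): `[s one pair] − [s joins ab]·[t separates ab]`. -/
def kernel17Z (s t : Fin 5) : ℤ :=
  ((if s = 1 then 1 else 0) + (if s = 2 then 1 else 0) + (if s = 3 then 1 else 0)) -
    ((if s = 0 then 1 else 0) + (if s = 1 then 1 else 0)) *
      ((if t = 2 then 1 else 0) + (if t = 3 then 1 else 0) + (if t = 4 then 1 else 0))

/-- `kernel17Z + 1 ∈ {0, 1, 2}` packed into 2-bit fields at the codes `s * 5 + t`. -/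
def k17Packed : ℕ := 375666472478725

/-- The packed entry `kernel17Z(s, t) + 1` at a code `c = s * 5 + t`. -/
def k17Entry (c : ℕ) : ℕ := (k17Packed >>> (2 * c)) &&& 3

/-- The packed entry at the code of `(s, t)` is `kernel17Z(s, t) + 1` (`25` cases). -/
theorem k17Entry_eq (s t : Fin 5) : (k17Entry (s.val * 5 + t.val) : ℤ) = kernel17Z s t + 1 := by
  revert s t
  decide +kernel

namespace MultiGraph

variable {V E : Type*} (G : MultiGraph V E) [DecidableEq V] [Fintype V] [Fintype E] [DecidableEq E]

/-- The row (`rgs3` index) of the three connection atoms `a~b`, `a~c`, `b~c` of a partition: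
`abc = 0`, `ab|c = 1`, `ac|b = 2`, `bc|a = 3`, `a|b|c = 4`. -/
def rowOf3 (ab ac bc : Bool) : Fin 5 :=
  if ab then (if ac then 0 else 1) else if ac then 2 else if bc then 3 else 4

/-- The computable row of the marked partition of the marks `a, b, c` (p6's breadth-first `connD`). -/
def row3D (a b c : V) (ω : Config E) : Fin 5 :=
  rowOf3 (G.connD ω a b) (G.connD ω a c) (G.connD ω b c)

omit [DecidableEq E] in
/-- **The row identifies the marked partition**: `Π(ω) = ker (rgs3 s)` iff the computable row is `s`. -/
theorem markedPartition_eq_ker_iff (a b c : V) (ω : Config E) (s : Fin 5) :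
    G.markedPartition ω ![a, b, c] = Setoid.ker (rgs3 s) ↔ G.row3D a b c ω = s := by
  have key : G.markedPartition ω ![a, b, c] = Setoid.ker (rgs3 s) ↔
      ω ∈ G.partitionEvent ![a, b, c] (rgs3 s) := by
    rw [G.partitionEvent_eq_partitionSetoidEvent]
    rfl
  rw [key]
  obtain ⟨h1, h2, h3⟩ := G.conn_three_trans a b c (ω := ω)
  unfold row3D rowOf3
  rw [connD_eq_decide, connD_eq_decide, connD_eq_decide]
  fin_cases s
  · show ω ∈ G.partitionEvent ![a, b, c] ![0, 0, 0] ↔ _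
    rw [G.partitionEvent_row_abc]
    simp only [Set.mem_inter_iff, mem_connEvent, decide_eq_true_eq]
    split_ifs <;> simp <;> tauto
  · show ω ∈ G.partitionEvent ![a, b, c] ![0, 0, 1] ↔ _
    rw [G.partitionEvent_row_ab_c]
    simp only [Set.mem_inter_iff, mem_connEvent, mem_sepEvent, decide_eq_true_eq]
    split_ifs <;> simp <;> tauto
  · show ω ∈ G.partitionEvent ![a, b, c] ![0, 1, 0] ↔ _
    rw [G.partitionEvent_row_ac_b]
    simp only [Set.mem_inter_iff, mem_connEvent, mem_sepEvent, decide_eq_true_eq]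
    split_ifs <;> simp <;> tauto
  · show ω ∈ G.partitionEvent ![a, b, c] ![0, 1, 1] ↔ _
    rw [G.partitionEvent_row_bc_a]
    simp only [Set.mem_inter_iff, mem_connEvent, mem_sepEvent, decide_eq_true_eq]
    split_ifs <;> simp <;> tauto
  · show ω ∈ G.partitionEvent ![a, b, c] ![0, 1, 2] ↔ _
    rw [G.partitionEvent_row_a_b_c]
    simp only [Set.mem_inter_iff, mem_sepEvent, decide_eq_true_eq]
    split_ifs <;> simp <;> tauto

omit [DecidableEq E] in
/-- typer-2's row indicator through the computable row. -/
theorem rowInd3_eq (a b c : V) (ω : Config E) (s : Fin 5) :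
    rowInd3 s (G.markedPartition ω ![a, b, c]) = if G.row3D a b c ω = s then 1 else 0 := by
  unfold rowInd3
  by_cases h : G.markedPartition ω ![a, b, c] = Setoid.ker (rgs3 s)
  · rw [if_pos h, if_pos ((G.markedPartition_eq_ker_iff a b c ω s).mp h)]
  · rw [if_neg h, if_neg fun h' => h ((G.markedPartition_eq_ker_iff a b c ω s).mpr h')]

omit [DecidableEq E] in
/-- **`kernel17` is the integer kernel of the two rows.** -/
theorem kernel17_eq (a b c : V) (ω ω' : Config E) :
    kernel17 (G.markedPartition ω ![a, b, c]) (G.markedPartition ω' ![a, b, c]) =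
      (kernel17Z (G.row3D a b c ω) (G.row3D a b c ω') : ℝ) := by
  unfold kernel17 kernel17Z
  simp only [rowInd3_eq]
  push_cast
  rfl

/-- The integer class sum of `kernel17` on the full cube (ordered antipodal pairs). -/
def cubeSum17Z (a b c : V) : ℤ :=
  ∑ ω : Config E, kernel17Z (G.row3D a b c ω) (G.row3D a b c ωᶜ)

/-- **The C-017 class sum is the integer sum.** -/
theorem cubeSumQuad_kernel17_eq (a b c : V) :
    G.cubeSumQuad ![a, b, c] kernel17 = (G.cubeSum17Z a b c : ℝ) := by
  unfold cubeSumQuad cubeSum cubeSum17Z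
  push_cast
  exact Finset.sum_congr rfl fun ω _ => G.kernel17_eq a b c ω ωᶜ

/-- The integer slack of `kernel17` on the face `[⊥, u]`: the full cube of the spanning subgraph with
edge set `u`, each point paired with its antipode in the face. -/
def faceSlack17Z (a b c : V) (u : Config E) : ℤ :=
  ∑ ω ∈ Finset.univ.filter (fun ω : Config E => ω ≤ u),
    kernel17Z (G.row3D a b c ω) (G.row3D a b c (antipode u ⊥ ω))

end MultiGraph

/-! ### A subgraph's class sum is a face slack of the supergraph -/

namespace MultiGraph

variable {V E' : Type*} {k : ℕ} (G : MultiGraph V E') (H : MultiGraph V (Fin k))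
  [DecidableEq V] [Fintype V] [Fintype E'] [DecidableEq E']

omit [DecidableEq E'] in
/-- The rows agree along the extension. -/
theorem row3D_ext {ι : E' → Fin k} (h : G.SubOf H ι) (a b c : V) (ρ : Config E') :
    H.row3D a b c (ext ι ρ) = G.row3D a b c ρ := by
  unfold row3D
  rw [connD_eq_decide, connD_eq_decide, connD_eq_decide, connD_eq_decide, connD_eq_decide,
    connD_eq_decide]
  rw [decide_eq_decide.mpr (G.conn_ext_iff H h ρ a b), decide_eq_decide.mpr (G.conn_ext_iff H h ρ a c),
    decide_eq_decide.mpr (G.conn_ext_iff H h ρ b c)]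

/-- **The full-cube class sum of a subgraph is the face slack `[⊥, u_ι]` of the supergraph.** -/
theorem cubeSum17Z_eq_faceSlack17Z_sub {ι : E' → Fin k} (h : G.SubOf H ι) (a b c : V) :
    G.cubeSum17Z a b c = H.faceSlack17Z a b c (imageMask ι) := by
  unfold cubeSum17Z faceSlack17Z
  refine Finset.sum_nbij' (fun ρ => ext ι ρ) (fun ω => fun e => ω (ι e)) ?_ ?_ ?_ ?_ ?_
  · intro ρ _
    exact Finset.mem_filter.mpr ⟨Finset.mem_univ _, ext_le_imageMask ι ρ⟩
  · intro ω _
    exact Finset.mem_univ _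
  · intro ρ _
    funext e
    exact ext_apply ι h.1 ρ e
  · intro ω hω
    exact eq_ext_of_le ι h.1 (Finset.mem_filter.mp hω).2
  · intro ρ _
    rw [← ext_compl ι h.1, G.row3D_ext H h, G.row3D_ext H h]

end MultiGraph

/-! ### The face check on codes, for graphs on `Fin n` vertices and `Fin k` edges -/

namespace MultiGraph

variable {n k : ℕ} (G : MultiGraph (Fin n) (Fin k))

/-- The code `0` is the all-closed configuration. -/
theorem cfgOf_zero : cfgOf k 0 = (⊥ : Config (Fin k)) := by
  funext e
  simp [cfgOf]

/-- The fast row of a configuration code (mask connectivity). -/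
def row3M (a b c : Fin n) (x : ℕ) : ℕ :=
  (rowOf3 (G.connM x a b) (G.connM x a c) (G.connM x b c)).val

/-- The fast row is the row of `cfgOf k x`. -/
theorem row3M_eq (a b c : Fin n) (x : ℕ) : G.row3M a b c x = (G.row3D a b c (cfgOf k x)).val := by
  unfold row3M row3D
  rw [connM_eq_connD, connM_eq_connD, connM_eq_connD]

/-- The fast rows as `Fin 16` digits. -/
def rowDigit3M (a b c : Fin n) (x : Fin (2 ^ k)) : Fin 16 :=
  ⟨G.row3M a b c x.val, by
    rw [row3M_eq]; exact lt_trans (G.row3D a b c (cfgOf k x.val)).isLt (by norm_num)⟩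

/-- **The row table** of the marks `a, b, c`: all `2^k` rows as base-`16` digits of one natural
number; computed once and forced to a literal. -/
def rowTable3M (a b c : Fin n) : ℕ := (finFunctionFinEquiv (G.rowDigit3M a b c)).val

/-- The table reads back the rows. -/
theorem rowAt_rowTable3M (a b c : Fin n) (x : Fin (2 ^ k)) :
    rowAt (G.rowTable3M a b c) x.val = G.row3M a b c x.val := by
  have h := congrArg (fun f => (f x).val)
    (Equiv.symm_apply_apply finFunctionFinEquiv (G.rowDigit3M a b c))
  exact h

/-- The face score of `[⊥, u]` on codes: the packed entries `kernel17Z + 1` over the listed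
sub-masks `d` of `u`, the antipode being `u ∧ ¬d`. -/
def subScore17 (k T u : ℕ) : ℕ :=
  ((subs u k).map fun d => k17Entry (rowAt T d * 5 + rowAt T (antipodeCode k u 0 d))).sum

/-- The number of points of the face `[⊥, u]` as a list sum. -/
def subSize (k u : ℕ) : ℕ := ((subs u k).map fun _ => 1).sum

/-- **The face slack `[⊥, u]` is score − size** read from the row table. -/
theorem faceSlack17Z_eq_table (a b c : Fin n) (u : Fin (2 ^ k)) :
    G.faceSlack17Z a b c (cfgOf k u.val) =
      (subScore17 k (G.rowTable3M a b c) u.val : ℤ) - subSize k u.val := by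
  unfold faceSlack17Z subScore17 subSize
  rw [Finset.sum_filter, ← sum_cfgOf, sum_subs, sum_subs]
  push_cast
  rw [← Finset.sum_sub_distrib]
  refine Finset.sum_congr rfl fun x _ => ?_
  rw [if_congr (subMask_iff x.isLt u.val).symm rfl rfl]
  split_ifs with h
  · have ha : antipodeCode k u.val 0 x.val < 2 ^ k :=
      antipodeCode_lt u.isLt (by positivity) x.val
    rw [rowAt_rowTable3M, show antipodeCode k u.val 0 x.val = (⟨_, ha⟩ : Fin (2 ^ k)).val from rfl,
      rowAt_rowTable3M, row3M_eq, row3M_eq, cfgOf_antipodeCode, cfgOf_zero, k17Entry_eq]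
    ring
  · simp

/-- **The kernel check**: the row table once, then every face `[⊥, u]` has score ≥ size
(`Σ_u 2^{|u|} = 3^k` points). -/
def Check17 (a b c : Fin n) : Bool :=
  withLitB (G.rowTable3M a b c) fun T =>
    decide (∀ u : Fin (2 ^ k), subSize k u.val ≤ subScore17 k T u.val)

/-- **From the kernel check to the face slacks**: `Check17 = true` gives `0 ≤ faceSlack17Z` on
every face `[⊥, u]`. -/
theorem faceSlack17Z_nonneg_of_check (a b c : Fin n) (h : G.Check17 a b c = true)
    (u : Config (Fin k)) : 0 ≤ G.faceSlack17Z a b c u := by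
  unfold Check17 at h
  rw [withLitB_eq, decide_eq_true_iff] at h
  obtain ⟨x, rfl⟩ := exists_cfgOf u
  rw [faceSlack17Z_eq_table]
  have hx := h x
  omega

/-- The check restricted to the joins `lo ≤ u < hi` (a slice of the kernel's work). -/
def Range17 (a b c : Fin n) (lo hi : ℕ) : Prop :=
  ∀ u : Fin (2 ^ k), lo ≤ u.val → u.val < hi →
    withLitB (G.rowTable3M a b c) (fun T => decide (subSize k u.val ≤ subScore17 k T u.val)) = true

/-- The slice is decidable. -/
instance (a b c : Fin n) (lo hi : ℕ) : Decidable (G.Range17 a b c lo hi) := by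
  unfold Range17; infer_instance

/-- Two adjacent slices chain. -/
theorem range17_trans (a b c : Fin n) {lo mid hi : ℕ} (h₁ : G.Range17 a b c lo mid)
    (h₂ : G.Range17 a b c mid hi) : G.Range17 a b c lo hi := by
  intro u hlo hhi
  by_cases h : u.val < mid
  · exact h₁ u hlo h
  · exact h₂ u (not_lt.mp h) hhi

/-- The full slice is the check. -/
theorem check17_of_range17 (a b c : Fin n) (h : G.Range17 a b c 0 (2 ^ k)) :
    G.Check17 a b c = true := by
  unfold Check17
  rw [withLitB_eq, decide_eq_true_iff]
  intro u
  have := h u (Nat.zero_le _) u.isLt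
  rw [withLitB_eq, decide_eq_true_iff] at this
  exact this

end MultiGraph

end PercRepro
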